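import Mathlib.Analysis.SpecialFunctions.Trigonometric.Angle
import Mathlib.Analysis.SpecialFunctions.Complex.Arg
import Mathlib.Analysis.SpecialFunctions.Sqrt
import Mathlib.Analysis.InnerProductSpace.PiL2
import Mathlib.Topology.Instances.AddCircle.Real
import Mathlib.Topology.Homeomorph.Lemmas
import HarnessLib

/-!
# The torus of revolution in `ℝ³` is homeomorphic to `S¹ × S¹`

Topic `Literature/Topology/Euclidean`.  For real parameters `a > r > 0` and `e ≠ 0` let

  `T(a, r, e) = {(x, y, z) ∈ ℝ³ | e² (x² + y² − a)² + r² z² = r² e²}`    (`quarticTorus a r e`)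

be the surface of revolution about the `z`-axis of the closed curve `ρ² = a + r cos φ`,
`z = e sin φ` (`ρ = √(x² + y²)`), a quartic level set — the shape in which tori occur as regular
level sets / boundaries of tubular neighbourhoods of a circle in Morse theory (e.g. the boundary
of a genus-`1` handlebody `{(ρ² − a)² + (r/e)² z² ≤ r²}`).  We prove (`torusHomeomorph`) that the
standard parametrisation by longitude and meridian angle,

  `(θ, φ) ↦ (ρ(φ) cos θ, ρ(φ) sin θ, e sin φ)`,  `ρ(φ) = √(a + r cos φ)`    (`torusParam a r e`),

is a **homeomorphism `ℝ/2πℤ × ℝ/2πℤ ≃ₜ T(a, r, e)`** (angles are Mathlib's `Real.Angle`, a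
synonym of `AddCircle (2π)`; `torusHomeomorphAddCircle` is the same map with that type): it is
continuous, injective (`φ` is recovered from `((x² + y² − a)/r, z/e) = (cos φ, sin φ)`, then `θ`
from `(x, y)/ρ(φ)`; `Real.Angle.cos_sin_inj`) and onto (`Complex.arg` produces the angles), from a
compact space to a Hausdorff one (`Continuous.homeoOfEquivCompactToT2`).  Hence every such torus
has the fundamental group of `S¹ × S¹`, `ℤ × ℤ` (Hatcher, Example 1.13;
`Literature/AlgebraicTopology/FundamentalGroup/CircleAndTorus.lean`).  Standard material:
this is the quartic analogue of do Carmo's torus of revolution (*Differential Geometry of Curves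
and Surfaces* (1976), §2-2, Example 4, which treats the circular torus
`(√(x² + y²) − a)² + z² = r²` and its parametrisation `((a + r cos u) cos v, (a + r cos u) sin v,
r sin u)`; the reference is an analogue, not a locator for the present statement).  Everything is
proved (`Real.Angle.cos_sq_add_sin_sq`, `Real.Angle.cos_sin_inj` and `Complex.cos_arg/sin_arg`
from Mathlib do the trigonometry); there are no named facts.
-/

noncomputable section

open Set Function Real

namespace Literature.Topology.Euclidean

variable {a r e : ℝ}

/-- The **quartic torus of revolution** with parameters `a, r, e`:
`T(a, r, e) = {(x, y, z) ∈ ℝ³ | e² (x² + y² − a)² + r² z² = r² e²}`, i.e. (for `r, e > 0`)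
`((x² + y² − a)/r)² + (z/e)² = 1`: the surface swept by the closed curve `ρ² = a + r cos φ`,
`z = e sin φ` of the `(ρ, z)` half-plane (`ρ = √(x² + y²)`) rotating about the `z`-axis; for
`a > r > 0` the curve misses the axis and `T(a, r, e)` is an embedded torus.  It is the level set
`{(ρ² − a)² + (r/e)² z² = r²}` of a polynomial, which is how tori arise as regular level sets
(boundaries of tubular neighbourhoods of a circle) in Morse theory. [folklore] -/
def quarticTorus (a r e : ℝ) : Set (EuclideanSpace ℝ (Fin 3)) :=
  {p | e ^ 2 * (p 0 ^ 2 + p 1 ^ 2 - a) ^ 2 + r ^ 2 * p 2 ^ 2 = r ^ 2 * e ^ 2}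

/-- Membership in the quartic torus, unfolded. [folklore] -/
theorem mem_quarticTorus_iff (p : EuclideanSpace ℝ (Fin 3)) :
    p ∈ quarticTorus a r e ↔
      e ^ 2 * (p 0 ^ 2 + p 1 ^ 2 - a) ^ 2 + r ^ 2 * p 2 ^ 2 = r ^ 2 * e ^ 2 :=
  Iff.rfl

/-- The radial profile `ρ(φ) = √(a + r cos φ)` of the meridian curve. [folklore] -/
def torusRadius (a r : ℝ) (φ : Real.Angle) : ℝ := √(a + r * φ.cos)

/-- For `0 ≤ r < a` the quantity under the root is positive: `a + r cos φ ≥ a − r > 0`. [folklore] -/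
theorem torusRadius_arg_pos (hra : r < a) (hr : 0 ≤ r) (φ : Real.Angle) : 0 < a + r * φ.cos := by
  have hc : -1 ≤ φ.cos := by
    induction φ using Real.Angle.induction_on with
    | _ x => rw [Real.Angle.cos_coe]; exact Real.neg_one_le_cos x
  nlinarith

/-- The radial profile is positive. [folklore] -/
theorem torusRadius_pos (hra : r < a) (hr : 0 ≤ r) (φ : Real.Angle) : 0 < torusRadius a r φ :=
  Real.sqrt_pos.2 (torusRadius_arg_pos hra hr φ)

/-- `ρ(φ)² = a + r cos φ`. [folklore] -/
theorem torusRadius_sq (hra : r < a) (hr : 0 ≤ r) (φ : Real.Angle) :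
    torusRadius a r φ ^ 2 = a + r * φ.cos :=
  Real.sq_sqrt (torusRadius_arg_pos hra hr φ).le

/-- The radial profile is continuous in `φ`. [folklore] -/
theorem continuous_torusRadius : Continuous (torusRadius a r) :=
  (continuous_const.add (continuous_const.mul Real.Angle.continuous_cos)).sqrt

/-- **The standard parametrisation of the torus of revolution** by two angles:
`(θ, φ) ↦ (ρ(φ) cos θ, ρ(φ) sin θ, e sin φ)` with `ρ(φ) = √(a + r cos φ)` (longitude `θ`,
meridian angle `φ`). [folklore] -/
def torusParam (a r e : ℝ) (θφ : Real.Angle × Real.Angle) : EuclideanSpace ℝ (Fin 3) :=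
  !₂[torusRadius a r θφ.2 * θφ.1.cos, torusRadius a r θφ.2 * θφ.1.sin, e * θφ.2.sin]

/-- First coordinate of the parametrisation: `x = ρ(φ) cos θ`. [folklore] -/
@[simp] theorem torusParam_apply_zero (θφ : Real.Angle × Real.Angle) :
    torusParam a r e θφ 0 = torusRadius a r θφ.2 * θφ.1.cos := by
  simp [torusParam]

/-- Second coordinate of the parametrisation: `y = ρ(φ) sin θ`. [folklore] -/
@[simp] theorem torusParam_apply_one (θφ : Real.Angle × Real.Angle) :
    torusParam a r e θφ 1 = torusRadius a r θφ.2 * θφ.1.sin := by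
  simp [torusParam]

/-- Third coordinate of the parametrisation: `z = e sin φ`. [folklore] -/
@[simp] theorem torusParam_apply_two (θφ : Real.Angle × Real.Angle) :
    torusParam a r e θφ 2 = e * θφ.2.sin := by
  simp [torusParam]

/-- The parametrisation is continuous. [folklore] -/
theorem continuous_torusParam : Continuous (torusParam a r e) := by
  unfold torusParam
  have h1 : Continuous fun θφ : Real.Angle × Real.Angle => torusRadius a r θφ.2 :=
    continuous_torusRadius.comp continuous_snd
  have h2 : Continuous fun θφ : Real.Angle × Real.Angle => θφ.1.cos :=
    Real.Angle.continuous_cos.comp continuous_fst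
  have h3 : Continuous fun θφ : Real.Angle × Real.Angle => θφ.1.sin :=
    Real.Angle.continuous_sin.comp continuous_fst
  have h4 : Continuous fun θφ : Real.Angle × Real.Angle => θφ.2.sin :=
    Real.Angle.continuous_sin.comp continuous_snd
  fun_prop

/-- `x² + y² = ρ(φ)²` along the parametrisation. [folklore] -/
theorem torusParam_sq_add_sq (hra : r < a) (hr : 0 ≤ r) (θφ : Real.Angle × Real.Angle) :
    torusParam a r e θφ 0 ^ 2 + torusParam a r e θφ 1 ^ 2 = a + r * θφ.2.cos := by
  rw [torusParam_apply_zero, torusParam_apply_one, mul_pow, mul_pow, ← mul_add,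
    Real.Angle.cos_sq_add_sin_sq, mul_one, torusRadius_sq hra hr]

/-- The parametrisation lands in the quartic torus. [folklore] -/
theorem torusParam_mem (hra : r < a) (hr : 0 ≤ r) (θφ : Real.Angle × Real.Angle) :
    torusParam a r e θφ ∈ quarticTorus a r e := by
  rw [mem_quarticTorus_iff, torusParam_sq_add_sq hra hr, torusParam_apply_two]
  have h := Real.Angle.cos_sq_add_sin_sq θφ.2
  linear_combination r ^ 2 * e ^ 2 * h

/-- Two angles with the same cosine and sine are equal. [folklore] -/
theorem angle_eq_of_cos_eq_of_sin_eq {θ ψ : Real.Angle} (hc : θ.cos = ψ.cos) (hs : θ.sin = ψ.sin) :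
    θ = ψ := by
  induction θ using Real.Angle.induction_on with
  | _ x =>
  induction ψ using Real.Angle.induction_on with
  | _ y =>
  rw [Real.Angle.cos_coe, Real.Angle.cos_coe] at hc
  rw [Real.Angle.sin_coe, Real.Angle.sin_coe] at hs
  exact Real.Angle.cos_sin_inj hc hs

/-- **The parametrisation is injective** for `a > r > 0`, `e ≠ 0`: the meridian angle `φ` is
recovered from `(x² + y² − a)/r = cos φ` and `z/e = sin φ`, then the longitude `θ` from
`(x, y)/ρ(φ)`. [folklore] -/
theorem torusParam_injective (hra : r < a) (hr : 0 < r) (he : e ≠ 0) :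
    Injective (torusParam a r e) := by
  rintro ⟨θ, φ⟩ ⟨θ', φ'⟩ h
  have h0 := congrArg (fun p : EuclideanSpace ℝ (Fin 3) => p 0) h
  have h1 := congrArg (fun p : EuclideanSpace ℝ (Fin 3) => p 1) h
  have h2 := congrArg (fun p : EuclideanSpace ℝ (Fin 3) => p 2) h
  have hsq := torusParam_sq_add_sq (e := e) hra hr.le (θ, φ)
  rw [h0, h1, torusParam_sq_add_sq hra hr.le (θ', φ')] at hsq
  simp only [torusParam_apply_zero, torusParam_apply_one, torusParam_apply_two] at h0 h1 h2
  dsimp only at h0 h1 h2 hsq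
  have hcos : φ.cos = φ'.cos := by
    have := mul_left_cancel₀ hr.ne' (add_left_cancel hsq.symm)
    exact this
  have hsin : φ.sin = φ'.sin := mul_left_cancel₀ he h2
  obtain rfl : φ = φ' := angle_eq_of_cos_eq_of_sin_eq hcos hsin
  have hρ := (torusRadius_pos hra hr.le φ).ne'
  obtain rfl : θ = θ' :=
    angle_eq_of_cos_eq_of_sin_eq (mul_left_cancel₀ hρ h0) (mul_left_cancel₀ hρ h1)
  rfl

/-- A point of the unit circle is `(cos θ, sin θ)` for some angle `θ`. [folklore] -/
theorem exists_angle_of_sq_add_sq_eq_one {u v : ℝ} (h : u ^ 2 + v ^ 2 = 1) :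
    ∃ θ : Real.Angle, θ.cos = u ∧ θ.sin = v := by
  have hz : (⟨u, v⟩ : ℂ) ≠ 0 := by
    intro h0
    have := congrArg Complex.re h0
    have := congrArg Complex.im h0
    simp_all
  refine ⟨(Complex.arg ⟨u, v⟩ : Real.Angle), ?_, ?_⟩
  · rw [Real.Angle.cos_coe, Complex.cos_arg hz]
    simp [Complex.norm_def, Complex.normSq, ← sq, h]
  · rw [Real.Angle.sin_coe, Complex.sin_arg]
    simp [Complex.norm_def, Complex.normSq, ← sq, h]

/-- **The parametrisation is onto the quartic torus** for `a > r > 0`, `e ≠ 0`. [folklore] -/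
theorem exists_torusParam_eq (hra : r < a) (hr : 0 < r) (he : e ≠ 0)
    {p : EuclideanSpace ℝ (Fin 3)} (hp : p ∈ quarticTorus a r e) :
    ∃ θφ : Real.Angle × Real.Angle, torusParam a r e θφ = p := by
  rw [mem_quarticTorus_iff] at hp
  -- the meridian angle
  set u : ℝ := (p 0 ^ 2 + p 1 ^ 2 - a) / r with hu
  set v : ℝ := p 2 / e with hv
  have huv : u ^ 2 + v ^ 2 = 1 := by
    rw [hu, hv, div_pow, div_pow]
    field_simp
    linear_combination hp
  obtain ⟨φ, hφc, hφs⟩ := exists_angle_of_sq_add_sq_eq_one huv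
  have hR2 : p 0 ^ 2 + p 1 ^ 2 = a + r * φ.cos := by
    rw [hφc, hu]; field_simp; ring
  have hRpos : 0 < p 0 ^ 2 + p 1 ^ 2 := hR2 ▸ torusRadius_arg_pos hra hr.le φ
  -- the longitude
  set R : ℝ := √(p 0 ^ 2 + p 1 ^ 2) with hR
  have hR0 : 0 < R := Real.sqrt_pos.2 hRpos
  have hRsq : R ^ 2 = p 0 ^ 2 + p 1 ^ 2 := Real.sq_sqrt hRpos.le
  have hcs : (p 0 / R) ^ 2 + (p 1 / R) ^ 2 = 1 := by
    rw [div_pow, div_pow, ← add_div, hRsq, div_self hRpos.ne']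
  obtain ⟨θ, hθc, hθs⟩ := exists_angle_of_sq_add_sq_eq_one hcs
  have hρ : torusRadius a r φ = R := by
    rw [torusRadius, ← hR2]
  refine ⟨(θ, φ), ?_⟩
  ext i
  fin_cases i
  · show torusParam a r e (θ, φ) 0 = p 0
    rw [torusParam_apply_zero]
    show torusRadius a r φ * θ.cos = p 0
    rw [hρ, hθc, mul_div_cancel₀ _ hR0.ne']
  · show torusParam a r e (θ, φ) 1 = p 1
    rw [torusParam_apply_one]
    show torusRadius a r φ * θ.sin = p 1
    rw [hρ, hθs, mul_div_cancel₀ _ hR0.ne']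
  · show torusParam a r e (θ, φ) 2 = p 2
    rw [torusParam_apply_two]
    show e * φ.sin = p 2
    rw [hφs, hv, mul_div_cancel₀ _ he]

/-- The parametrisation as a bijection onto the quartic torus. [folklore] -/
def torusParamEquiv (hra : r < a) (hr : 0 < r) (he : e ≠ 0) :
    Real.Angle × Real.Angle ≃ quarticTorus a r e :=
  Equiv.ofBijective (fun θφ => ⟨torusParam a r e θφ, torusParam_mem hra hr.le θφ⟩)
    ⟨fun _ _ h => torusParam_injective hra hr he (congrArg Subtype.val h),
      fun p => by
        obtain ⟨θφ, h⟩ := exists_torusParam_eq hra hr he p.2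
        exact ⟨θφ, Subtype.ext h⟩⟩

/-- `Real.Angle = ℝ/2πℤ` is compact. [folklore] -/
instance compactSpace_angle : CompactSpace Real.Angle := by
  haveI : Fact (0 < 2 * π) := ⟨Real.two_pi_pos⟩
  exact inferInstanceAs (CompactSpace (AddCircle (2 * π)))

/-- **The torus of revolution is homeomorphic to `S¹ × S¹`**: for `a > r > 0` and `e ≠ 0`, the
standard parametrisation `(θ, φ) ↦ (ρ(φ) cos θ, ρ(φ) sin θ, e sin φ)` is a homeomorphism
`ℝ/2πℤ × ℝ/2πℤ ≃ₜ T(a, r, e)` (a continuous bijection from a compact space to a Hausdorff space).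
[folklore] -/
def torusHomeomorph (hra : r < a) (hr : 0 < r) (he : e ≠ 0) :
    Real.Angle × Real.Angle ≃ₜ quarticTorus a r e :=
  Continuous.homeoOfEquivCompactToT2 (f := torusParamEquiv hra hr he)
    (continuous_torusParam.subtype_mk _)

/-- The homeomorphism is the parametrisation. [folklore] -/
@[simp] theorem torusHomeomorph_apply_coe (hra : r < a) (hr : 0 < r) (he : e ≠ 0)
    (θφ : Real.Angle × Real.Angle) :
    (torusHomeomorph hra hr he θφ : EuclideanSpace ℝ (Fin 3)) = torusParam a r e θφ :=
  rfl

/-- The same homeomorphism with the circle factors written as Mathlib's additive circle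
`AddCircle (2π)` (of which `Real.Angle` is a synonym). [folklore] -/
def torusHomeomorphAddCircle (hra : r < a) (hr : 0 < r) (he : e ≠ 0) :
    AddCircle (2 * π) × AddCircle (2 * π) ≃ₜ quarticTorus a r e :=
  torusHomeomorph hra hr he

end Literature.Topology.Euclidean

end
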